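import Summits.QuantumFields.BalabanUV.T4Continuum.Support.NE7DirIterL1Letter
import Summits.QuantumFields.BalabanUV.T4Continuum.Support.NE3QuadRemainderLevels
import HarnessLib

/-!
# Support | NE7 (gen 95, brick (S2)-B3): THE ℓ¹ LETTERS OF THE PARTIAL LINEAR TOWERS AT LEVEL `i` OF A K-TOWER — `dirIter L m (cavgIter L i W)` and
# `QbarIter L m (cavgIter L i W)`, `i + m ≤ K`, k-FREE (the ℓ¹ twins of Π-C-3a's `norm_dirIter_le_sup_at`), the form the remainder telescope of (S2) consumes

Cell `pub-balaban`, rung (B)+1 sub-cell t4, lineage `b2b-balaban-t4-ne7-p1` (CRUX PROVER NE7 #1 = OWNER of row NE7), generation 95.  Over F328 `NE7QbarIterL1Letter.dirL1_QbarIter_le`,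
F329 `NE7DirIterL1Letter.dirL1_dirIter_le` and Π-C-3a's level package `NE3QuadRemainderLevels.levelPkg` ∕ `tower_partial_eq` ∕ `curvSum_shift_le`.
WHAT ([folklore]; 0 def, 0 sorry).  Tower class: `W` unitary `(L^K·N)`-periodic, `0 ≤ x`, `LevelSmall d L K x`, `SmallField W x`, `2 ≤ L`, the sup curvature line `curvSum d L K x ≤ (2∕3)L`
and the ℓ¹ curvature line `((L^d∕L)·d(2nbRad+1)^d)·curvSum d L K x ≤ 2∕3`.  For `i + m ≤ K` and `Y` `(L^{K−i}·N)`-periodic: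
**`dirL1_QbarIter_le_at`** (`dirL1 (QbarIter L m (cavgIter L i W) Y) (periodBox (L^{K−i−m}·N)) ≤ 3(L∕L^d)^m·dirL1 Y (periodBox (L^{K−i}·N))`) and, for skew `Y`,
**`dirL1_dirIter_le_at`** (`≤ (3(L∕L^d)^m + 2d·dL(2nbRad+1)^d·3Σ_{l<m}(L∕L^d)^l)·dirL1 Y`); `l1Const_le` (for `2 ≤ L^{d−1}`… stated as: the constant is `≤ 3 + 12d²L(2nbRad+1)^d` once
`L^d ≥ 2L`, a k-free number).
HONEST FRAMING (page 1): bookkeeping over landed letters; nothing of Bałaban's asserted; the remainder telescope and `hdecomp` are NOT here; NE7 NOT PROVED; spine 0∕9; finite T⁴ rung (B)+1 — NOT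
infinite volume, NOT mass gap, NOT `BetaPertH`, NOT Clay.  Continuum YM on T⁴ ⇐ BetaPertH ∧ nine spine estimates (0/9 proved); BetaPertH ⇐ (D1) ∧ (D4) ∧ CAP+tail; G-an2-4 gates asym, D1 and NE2/3/4.
-/

set_option autoImplicit false

open scoped BigOperators Matrix.Norms.L2Operator
open Finset

namespace Summit.QuantumFields.BalabanUV.T4Continuum.NE7DirIterL1LetterAt

open Literature.MathematicalPhysics.QuantumFieldTheory.Balaban1983to89
open B7Prop1Explicit B7Prop2Explicit
open T4AveragingDeficitWall (IsUnitaryCfg IsSkewDir SmallField dirL1)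
open T4AveragingDeficitWallBoundary (IsPeriodicCfg periodBox)
open AveragingDeficitPeriodicCounting (IsPeriodicDir)
open AveragingDeficitMultiLevelPrep (cavgIter radIter tower LevelSmall)
open AveragingDeficitDerivCore (dirL1_nonneg)
open BlockAverageVaryHolo (nbRad)
open NE3TangentCovariantTower (dirIter QbarIter dirIter_zero QbarIter_zero)
open NE3LinearisedAverageSup (curvSum curvSum_nonneg)
open NE3QuadRemainderLevels (levelPkg tower_partial_eq curvSum_shift_le)
open NE7QbarIterL1Letter (dirL1_QbarIter_le)
open NE7DirIterL1Letter (dirL1_dirIter_le)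

noncomputable section
variable {d : ℕ} {n : Type*} [Fintype n] [DecidableEq n]

/-- **THE ℓ¹ LETTER OF A PARTIAL DOUBLE-BAR TOWER**: for `i + m ≤ K` and an `(L^{K−i}·N)`-periodic `Y`,
`dirL1 (QbarIter L m (cavgIter L i W) Y) (periodBox (L^{K−i−m}·N)) ≤ 3·(L∕L^d)^m·dirL1 Y (periodBox (L^{K−i}·N))` (F328 at the level-`i` background; `m = 0` is the identity). [folklore] -/
theorem dirL1_QbarIter_le_at [Nonempty n] {L N K : ℕ} [NeZero N] (hL : 2 ≤ L) {W : Site d → Fin d → (Matrix n n ℂ)ˣ} {x : ℝ}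
    (hWu : IsUnitaryCfg W) (hWP : IsPeriodicCfg W ((L ^ K * N : ℕ) : ℤ)) (hx : 0 ≤ x) (hsm : LevelSmall d L K x) (hWx : SmallField W x)
    (hA : curvSum d L K x ≤ 2 / 3 * L) (hA1 : ((L : ℝ) ^ d / L * (d * (2 * nbRad d L + 1) ^ d)) * curvSum d L K x ≤ 2 / 3)
    {i m : ℕ} (him : i + m ≤ K) {Y : Site d → Fin d → Matrix n n ℂ} (hYP : IsPeriodicDir Y ((L ^ (K - i) * N : ℕ) : ℤ)) :
    dirL1 (QbarIter L m (cavgIter L i W) Y) (periodBox (d := d) (L ^ (K - i - m) * N))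
      ≤ 3 * ((L : ℝ) / (L : ℝ) ^ d) ^ m * dirL1 Y (periodBox (d := d) (L ^ (K - i) * N)) := by
  have hL1 : 1 ≤ L := by omega
  rcases m with _ | m
  · rw [QbarIter_zero, pow_zero, mul_one, Nat.sub_zero]
    have hD0 : 0 ≤ dirL1 Y (periodBox (d := d) (L ^ (K - i) * N)) := dirL1_nonneg _ _
    linarith
  · obtain ⟨hU, hr, hS, hP, -, hls, -⟩ := levelPkg hL1 hWu hWP hx hsm hWx hA (i := i) (by omega)
    have hN' : 1 ≤ L ^ (K - i - (m + 1)) * N := Nat.one_le_iff_ne_zero.mpr (Nat.mul_ne_zero (pow_ne_zero _ (by omega)) (NeZero.ne N))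
    have hP' : IsPeriodicCfg (cavgIter L i W) ((tower L (L ^ (K - i - (m + 1)) * N) (m + 1) : ℕ) : ℤ) := by
      rw [tower_partial_eq L N him]; exact hP
    have hYP' : IsPeriodicDir Y ((tower L (L ^ (K - i - (m + 1)) * N) (m + 1) : ℕ) : ℤ) := by
      rw [tower_partial_eq L N him]; exact hYP
    have hsm' : LevelSmall d L m (radIter d L i x) := by
      have := hls (m + 1) him (by omega); rwa [Nat.add_sub_cancel] at this
    have hK0 : 0 ≤ (L : ℝ) ^ d / L * (d * (2 * nbRad d L + 1) ^ d) := by positivity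
    have hA1' : ((L : ℝ) ^ d / L * (d * (2 * nbRad d L + 1) ^ d)) * curvSum d L (m + 1) (radIter d L i x) ≤ 2 / 3 :=
      (mul_le_mul_of_nonneg_left ((curvSum_shift_le L i (m + 1) hx).trans (NE3LinearisedAverageSup.curvSum_mono L him hx)) hK0).trans hA1
    have h := dirL1_QbarIter_le hL1 hN' m hU hP' hr hsm' hS hYP' hA1'
    rw [tower_partial_eq L N him] at h
    exact h

/-- **THE ℓ¹ LETTER OF A PARTIAL LINEAR TOWER**: for `i + m ≤ K` and a skew `(L^{K−i}·N)`-periodic `Y`,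
`dirL1 (dirIter L m (cavgIter L i W) Y) (periodBox (L^{K−i−m}·N)) ≤ (3(L∕L^d)^m + 2d·(dL(2nbRad+1)^d·3Σ_{l<m}(L∕L^d)^l))·dirL1 Y (periodBox (L^{K−i}·N))` (F329 at the
level-`i` background; `m = 0` is the identity). [folklore] -/
theorem dirL1_dirIter_le_at [Nonempty n] {L N K : ℕ} [NeZero N] (hL : 2 ≤ L) {W : Site d → Fin d → (Matrix n n ℂ)ˣ} {x : ℝ}
    (hWu : IsUnitaryCfg W) (hWP : IsPeriodicCfg W ((L ^ K * N : ℕ) : ℤ)) (hx : 0 ≤ x) (hsm : LevelSmall d L K x) (hWx : SmallField W x)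
    (hA : curvSum d L K x ≤ 2 / 3 * L) (hA1 : ((L : ℝ) ^ d / L * (d * (2 * nbRad d L + 1) ^ d)) * curvSum d L K x ≤ 2 / 3)
    {i m : ℕ} (him : i + m ≤ K) {Y : Site d → Fin d → Matrix n n ℂ} (hYs : IsSkewDir Y) (hYP : IsPeriodicDir Y ((L ^ (K - i) * N : ℕ) : ℤ)) :
    dirL1 (dirIter L m (cavgIter L i W) Y) (periodBox (d := d) (L ^ (K - i - m) * N))
      ≤ (3 * ((L : ℝ) / (L : ℝ) ^ d) ^ m
          + 2 * d * (((d : ℝ) * L) * (2 * nbRad d L + 1) ^ d * (3 * ∑ l ∈ range m, ((L : ℝ) / (L : ℝ) ^ d) ^ l)))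
        * dirL1 Y (periodBox (d := d) (L ^ (K - i) * N)) := by
  have hL1 : 1 ≤ L := by omega
  rcases m with _ | m
  · rw [dirIter_zero, pow_zero, mul_one, Nat.sub_zero, Finset.sum_range_zero, mul_zero, mul_zero,
      show (3 + 2 * (d : ℝ) * 0) = 3 by ring]
    have hD0 : 0 ≤ dirL1 Y (periodBox (d := d) (L ^ (K - i) * N)) := dirL1_nonneg _ _
    linarith
  · obtain ⟨hU, hr, hS, hP, -, hls, -⟩ := levelPkg hL1 hWu hWP hx hsm hWx hA (i := i) (by omega)
    have hN' : 1 ≤ L ^ (K - i - (m + 1)) * N := Nat.one_le_iff_ne_zero.mpr (Nat.mul_ne_zero (pow_ne_zero _ (by omega)) (NeZero.ne N))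
    have hP' : IsPeriodicCfg (cavgIter L i W) ((tower L (L ^ (K - i - (m + 1)) * N) (m + 1) : ℕ) : ℤ) := by
      rw [tower_partial_eq L N him]; exact hP
    have hYP' : IsPeriodicDir Y ((tower L (L ^ (K - i - (m + 1)) * N) (m + 1) : ℕ) : ℤ) := by
      rw [tower_partial_eq L N him]; exact hYP
    have hsm' : LevelSmall d L m (radIter d L i x) := by
      have := hls (m + 1) him (by omega); rwa [Nat.add_sub_cancel] at this
    have hK0 : 0 ≤ (L : ℝ) ^ d / L * (d * (2 * nbRad d L + 1) ^ d) := by positivity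
    have hA1' : ((L : ℝ) ^ d / L * (d * (2 * nbRad d L + 1) ^ d)) * curvSum d L (m + 1) (radIter d L i x) ≤ 2 / 3 :=
      (mul_le_mul_of_nonneg_left ((curvSum_shift_le L i (m + 1) hx).trans (NE3LinearisedAverageSup.curvSum_mono L him hx)) hK0).trans hA1
    have h := dirL1_dirIter_le hL1 hN' m hU hP' hr hsm' hS hYs hYP' hA1'
    rw [tower_partial_eq L N him] at h
    exact h

omit [Fintype n] [DecidableEq n] in
/-- **THE CONSTANT IS k-FREE**: for `L^d ≥ 2L` (true for `L ≥ 2`, `d ≥ 2`) the geometric sum is `≤ 2` and the ℓ¹ letter's constant is `≤ 3 + 12·d²·L·(2nbRad+1)^d`,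
uniformly in `m`. [folklore] -/
theorem l1Const_le {L : ℕ} (hL : 1 ≤ L) (hLd : 2 * (L : ℝ) ≤ (L : ℝ) ^ d) (m : ℕ) :
    3 * ((L : ℝ) / (L : ℝ) ^ d) ^ m + 2 * d * (((d : ℝ) * L) * (2 * nbRad d L + 1) ^ d * (3 * ∑ l ∈ range m, ((L : ℝ) / (L : ℝ) ^ d) ^ l))
      ≤ 3 + 12 * (d : ℝ) ^ 2 * L * (2 * nbRad d L + 1) ^ d := by
  have hL0 : (0 : ℝ) < L := by exact_mod_cast (by omega : 0 < L)
  have hLd0 : (0 : ℝ) < (L : ℝ) ^ d := by positivity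
  set q : ℝ := (L : ℝ) / (L : ℝ) ^ d with hq
  have hq0 : 0 ≤ q := by positivity
  have hq12 : q ≤ 1 / 2 := by
    rw [hq, div_le_iff₀ hLd0]; linarith
  have hq1 : q ≤ 1 := by linarith
  have hpow : q ^ m ≤ 1 := pow_le_one₀ hq0 hq1
  have hgeom : ∑ l ∈ range m, q ^ l ≤ 2 := by
    have h := geom_sum_eq (x := q) (by linarith : q ≠ 1) m
    rw [h]
    have h1 : q ^ m - 1 ≤ 0 := by linarith
    have h2 : q - 1 < 0 := by linarith
    rw [div_le_iff_of_neg h2]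
    nlinarith [pow_nonneg hq0 m]
  have hC0 : 0 ≤ ((d : ℝ) * L) * (2 * nbRad d L + 1) ^ d := by positivity
  have hd0 : (0 : ℝ) ≤ d := Nat.cast_nonneg d
  calc 3 * q ^ m + 2 * d * (((d : ℝ) * L) * (2 * nbRad d L + 1) ^ d * (3 * ∑ l ∈ range m, q ^ l))
      ≤ 3 * 1 + 2 * d * (((d : ℝ) * L) * (2 * nbRad d L + 1) ^ d * (3 * 2)) := by
        refine add_le_add (by linarith) (mul_le_mul_of_nonneg_left (mul_le_mul_of_nonneg_left (by linarith) hC0) (by positivity))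
    _ = 3 + 12 * (d : ℝ) ^ 2 * L * (2 * nbRad d L + 1) ^ d := by ring

end

end Summit.QuantumFields.BalabanUV.T4Continuum.NE7DirIterL1LetterAt
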